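import Literature.NumberTheory.Sieve.DrappeauDispersionOrthogonality
import HarnessLib

/-!
# Drappeau 2017, §5.3.1/§5.4/§5.6: the main terms `X₁`, `X₃` and the identity (5.21)

S. Drappeau, *Sums of Kloosterman sums in arithmetic progressions, and the error term in the
dispersion method*, Proc. London Math. Soc. (3) 114 (2017) 684–732 = arXiv:1504.05549
(`Drappeau2017`; held as `paper:arxiv-1504.05549`, §5.3.1 on chunk 18, §5.4 on chunk 19, §5.6 on
chunk 21).

In the proof of **Theorem 5.1** (`Literature.NumberTheory.Sieve.Drappeau2017_theorem51`) the
dispersion sums `𝒮₃` and `𝒮₁` have the main terms `α̂(0) X₃` and `α̂(0) X₁`, where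
(5.16) `X₃ := ∑_{(q₁q₂,a₁a₂)=1} γ(q₁)γ(q₂)/([q₁,q₂] φ((q₁,q₂))) ∑_{χ₀ ∈ 𝒳_{(q₁,q₂)}(R)}
          ∑_{n₁,n₂, (nⱼ,qⱼa₂)=1} β_{n₁} β̄_{n₂} χ₀(n₁ n̄₂)`,
(5.20) `X₁ := ∑_{(q₁q₂,a₁a₂)=1} γ(q₁)γ(q₂)/[q₁,q₂] ∑_{n₁,n₂, (nⱼ,qⱼa₂)=1, n₁ ≡ n₂ (mod (q₁,q₂))}
          β_{n₁} β̄_{n₂}`,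
and §5.6 ("The main terms") states: "They combine to form
(5.21) `X₁ − X₃ = ∑_{(q₁q₂,a₁a₂)=1} γ(q₁)γ(q₂)/[q₁,q₂] ∑_{n₁,n₂,(nⱼ,qⱼa₂)=1} β̄_{n₁} β_{n₂}
          𝔲_R(n₁ n̄₂; (q₁,q₂))`."

This file DEFINES `X₁`, `X₃` and the right side of (5.21) for a real weight `γ` on a finite set of
moduli `𝒬` and coefficients `β` on a finite set `𝒩` (`mainX1`, `mainX3`, `mainTermsDiff`), and
PROVES (5.21) (`mainX1_sub_mainX3_eq`): subtracting (5.16) from (5.20) gives, by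
`𝔲_R(t; g) = 1_{t ≡ 1} − φ(g)⁻¹ ∑_{χ ∈ 𝒳_g(R)} χ(t)` (`mainKernel_add_uR_eq_ite`), the sum
`∑ … β_{n₁} β̄_{n₂} 𝔲_R(n₁ n̄₂; (q₁,q₂))`; the printed right side of (5.21) carries the bar on
`β_{n₁}` instead, which is the same number after the exchange `(q₁,n₁) ↔ (q₂,n₂)` because
`𝔲_R(t̄; g) = 𝔲_R(t; g)` for units `t` (`uR_inv_of_isUnit`: `χ ↦ χ̄` permutes the characters of
conductor `> R`).  The bound `X₁ − X₃ ≪ (log x)^{O(1)}(N + N²R⁻²)` of §5.6 is proved in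
`…DrappeauDispersionMainTermsBound`.

## References

* S. Drappeau, Proc. London Math. Soc. (3) 114 (2017) 684–732, arXiv:1504.05549, §5.3.1 (5.16),
  §5.4 (5.20), §5.6 (5.21). [Drappeau2017]
-/

noncomputable section

open Finset DirichletCharacter

namespace Literature.NumberTheory.Sieve

namespace Drappeau2017

/-! ### `𝔲_R` is even under `t ↦ t̄` -/

/-- `𝔲_R(t̄; d) = 𝔲_R(t; d)` for a unit `t`: `χ(t̄) = χ̄(t)` and `χ ↦ χ̄` is a bijection of the
characters `mod d` preserving the conductor. [cite: Drappeau2017, §5 (5.1)] -/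
theorem uR_inv_of_isUnit (R : ℝ) {d : ℕ} {t : ZMod d} (ht : IsUnit t) :
    uR R d t⁻¹ = uR R d t := by
  classical
  unfold uR
  congr 1
  refine Fintype.sum_equiv (Equiv.inv (DirichletCharacter ℂ d)) _ _ fun χ => ?_
  simp only [Equiv.inv_apply, conductor_inv]
  split_ifs
  · rw [apply_inv_of_isUnit χ ht, MulChar.inv_apply_eq_inv']
  · rfl

/-- For units `a, b mod d`: `𝔲_R(ā b; d) = 𝔲_R(a b̄; d)`. [cite: Drappeau2017, §5 (5.1)] -/
theorem uR_inv_mul_eq_uR_mul_inv (R : ℝ) {d : ℕ} {a b : ZMod d} (ha : IsUnit a) (hb : IsUnit b) :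
    uR R d (a⁻¹ * b) = uR R d (a * b⁻¹) := by
  obtain ⟨u, rfl⟩ := ha
  obtain ⟨v, rfl⟩ := hb
  have h1 : ((u : ZMod d))⁻¹ * (v : ZMod d) = ((u⁻¹ * v : (ZMod d)ˣ) : ZMod d) := by
    rw [Units.val_mul, ZMod.inv_coe_unit]
  have h2 : (u : ZMod d) * ((v : ZMod d))⁻¹ = (((u⁻¹ * v : (ZMod d)ˣ) : ZMod d))⁻¹ := by
    rw [ZMod.inv_coe_unit v, ZMod.inv_coe_unit (u⁻¹ * v), mul_inv_rev, inv_inv, Units.val_mul,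
      mul_comm]
  rw [h1, h2, uR_inv_of_isUnit R (Units.isUnit _)]

/-! ### `X₁`, `X₃` and the right side of (5.21) -/

/-- **`X₁`** of (5.20), the main term of `𝒮₁`: for the moduli `q ∈ 𝒬` coprime to `a₁a₂`
(weight `γ`) and `n ∈ 𝒩` coprime to `a₂`,
`X₁ = ∑_{q₁,q₂} γ(q₁)γ(q₂)/[q₁,q₂] ∑_{n₁,n₂: (nⱼ,qⱼ)=1, n₁ ≡ n₂ (mod (q₁,q₂))} β_{n₁} β̄_{n₂}`.
[cite: Drappeau2017, §5.4 (5.20)] -/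
def mainX1 (a₁ a₂ : ℤ) (𝒬 𝒩 : Finset ℕ) (γ : ℕ → ℝ) (β : ℕ → ℂ) : ℂ :=
  ∑ q₁ ∈ 𝒬.filter (fun q : ℕ => IsCoprime (q : ℤ) (a₁ * a₂)),
    ∑ q₂ ∈ 𝒬.filter (fun q : ℕ => IsCoprime (q : ℤ) (a₁ * a₂)),
      ((γ q₁ * γ q₂ / (Nat.lcm q₁ q₂ : ℝ) : ℝ) : ℂ) *
        ∑ n₁ ∈ (𝒩.filter (fun n : ℕ => IsCoprime (n : ℤ) a₂)).filter (fun n => n.Coprime q₁),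
          ∑ n₂ ∈ (𝒩.filter (fun n : ℕ => IsCoprime (n : ℤ) a₂)).filter (fun n => n.Coprime q₂),
            if (n₁ : ZMod (Nat.gcd q₁ q₂)) = (n₂ : ZMod (Nat.gcd q₁ q₂)) then
              β n₁ * starRingEnd ℂ (β n₂) else 0

/-- **`X₃`** of (5.16), the main term of `𝒮₃` (and of `𝒮₂`, (5.19)): with
`𝒳_g(R) = {χ mod g : cond χ ≤ R}`, `g = (q₁,q₂)`,
`X₃ = ∑_{q₁,q₂} γ(q₁)γ(q₂)/([q₁,q₂] φ(g)) ∑_{χ₀ ∈ 𝒳_g(R)} ∑_{n₁,n₂: (nⱼ,qⱼ)=1} β_{n₁} β̄_{n₂} χ₀(n₁ n̄₂)`.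
[cite: Drappeau2017, §5.3.1 (5.16)] -/
def mainX3 (R : ℝ) (a₁ a₂ : ℤ) (𝒬 𝒩 : Finset ℕ) (γ : ℕ → ℝ) (β : ℕ → ℂ) : ℂ :=
  ∑ q₁ ∈ 𝒬.filter (fun q : ℕ => IsCoprime (q : ℤ) (a₁ * a₂)),
    ∑ q₂ ∈ 𝒬.filter (fun q : ℕ => IsCoprime (q : ℤ) (a₁ * a₂)),
      ((γ q₁ * γ q₂ / (Nat.lcm q₁ q₂ : ℝ) : ℝ) : ℂ) *
        ((Nat.totient (Nat.gcd q₁ q₂) : ℂ))⁻¹ *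
        ∑ χ₀ ∈ (univ.filter fun χ : DirichletCharacter ℂ (Nat.gcd q₁ q₂) => (χ.conductor : ℝ) ≤ R),
          ∑ n₁ ∈ (𝒩.filter (fun n : ℕ => IsCoprime (n : ℤ) a₂)).filter (fun n => n.Coprime q₁),
            ∑ n₂ ∈ (𝒩.filter (fun n : ℕ => IsCoprime (n : ℤ) a₂)).filter (fun n => n.Coprime q₂),
              β n₁ * starRingEnd ℂ (β n₂) *
                χ₀ ((n₁ : ZMod (Nat.gcd q₁ q₂)) * ((n₂ : ZMod (Nat.gcd q₁ q₂)))⁻¹)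

/-- **The right side of (5.21)**:
`∑_{q₁,q₂} γ(q₁)γ(q₂)/[q₁,q₂] ∑_{n₂: (n₂,q₂)=1} ∑_{n₁: (n₁,q₁)=1} β_{n₂} β̄_{n₁} 𝔲_R(n̄₂ n₁; (q₁,q₂))`
(the printed `∑_{n₁,n₂,(nⱼ,qⱼa₂)=1} β̄_{n₁} β_{n₂} 𝔲_R(n₁ n̄₂; (q₁,q₂))`, summands reordered).
[cite: Drappeau2017, §5.6 (5.21)] -/
def mainTermsDiff (R : ℝ) (a₁ a₂ : ℤ) (𝒬 𝒩 : Finset ℕ) (γ : ℕ → ℝ) (β : ℕ → ℂ) : ℂ :=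
  ∑ q₁ ∈ 𝒬.filter (fun q : ℕ => IsCoprime (q : ℤ) (a₁ * a₂)),
    ∑ q₂ ∈ 𝒬.filter (fun q : ℕ => IsCoprime (q : ℤ) (a₁ * a₂)),
      ((γ q₁ * γ q₂ / (Nat.lcm q₁ q₂ : ℝ) : ℝ) : ℂ) *
        ∑ n₂ ∈ (𝒩.filter (fun n : ℕ => IsCoprime (n : ℤ) a₂)).filter (fun n => n.Coprime q₂),
          ∑ n₁ ∈ (𝒩.filter (fun n : ℕ => IsCoprime (n : ℤ) a₂)).filter (fun n => n.Coprime q₁),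
            β n₂ * starRingEnd ℂ (β n₁) *
              uR R (Nat.gcd q₁ q₂)
                (((n₂ : ZMod (Nat.gcd q₁ q₂)))⁻¹ * (n₁ : ZMod (Nat.gcd q₁ q₂)))

/-- The right side of (5.21) in the orientation of (5.20)/(5.16):
`∑_{q₁,q₂} γ(q₁)γ(q₂)/[q₁,q₂] ∑_{n₁: (n₁,q₁)=1} ∑_{n₂: (n₂,q₂)=1} β_{n₁} β̄_{n₂} 𝔲_R(n₁ n̄₂; (q₁,q₂))`
(exchange `(q₁,n₁) ↔ (q₂,n₂)` and `𝔲_R(t̄) = 𝔲_R(t)` for units `t`).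
[cite: Drappeau2017, §5.6 (5.21)] -/
theorem mainTermsDiff_eq (R : ℝ) (a₁ a₂ : ℤ) (𝒬 𝒩 : Finset ℕ) (γ : ℕ → ℝ) (β : ℕ → ℂ) :
    mainTermsDiff R a₁ a₂ 𝒬 𝒩 γ β =
      ∑ q₁ ∈ 𝒬.filter (fun q : ℕ => IsCoprime (q : ℤ) (a₁ * a₂)),
        ∑ q₂ ∈ 𝒬.filter (fun q : ℕ => IsCoprime (q : ℤ) (a₁ * a₂)),
          ((γ q₁ * γ q₂ / (Nat.lcm q₁ q₂ : ℝ) : ℝ) : ℂ) *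
            ∑ n₁ ∈ (𝒩.filter (fun n : ℕ => IsCoprime (n : ℤ) a₂)).filter (fun n => n.Coprime q₁),
              ∑ n₂ ∈ (𝒩.filter (fun n : ℕ => IsCoprime (n : ℤ) a₂)).filter (fun n => n.Coprime q₂),
                β n₁ * starRingEnd ℂ (β n₂) *
                  uR R (Nat.gcd q₁ q₂)
                    ((n₁ : ZMod (Nat.gcd q₁ q₂)) * ((n₂ : ZMod (Nat.gcd q₁ q₂)))⁻¹) := by
  unfold mainTermsDiff
  rw [Finset.sum_comm]
  refine Finset.sum_congr rfl fun q₁ _ => Finset.sum_congr rfl fun q₂ _ => ?_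
  rw [Nat.lcm_comm q₂ q₁, mul_comm (γ q₂) (γ q₁), Nat.gcd_comm q₂ q₁]
  congr 1
  refine Finset.sum_congr rfl fun n₁ hn₁ => Finset.sum_congr rfl fun n₂ hn₂ => ?_
  have hu₁ : IsUnit (n₁ : ZMod (Nat.gcd q₁ q₂)) :=
    (ZMod.isUnit_iff_coprime _ _).2
      ((Finset.mem_filter.1 hn₁).2.coprime_dvd_right (Nat.gcd_dvd_left q₁ q₂))
  have hu₂ : IsUnit (n₂ : ZMod (Nat.gcd q₁ q₂)) :=
    (ZMod.isUnit_iff_coprime _ _).2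
      ((Finset.mem_filter.1 hn₂).2.coprime_dvd_right (Nat.gcd_dvd_right q₁ q₂))
  rw [uR_inv_mul_eq_uR_mul_inv R hu₁ hu₂]

/-- **(5.21)** (Drappeau §5.6: "The main terms `X₁` and `X₃` defined in (5.20) and (5.16) …
combine to form `X₁ − X₃ = ∑ γ(q₁)γ(q₂)/[q₁,q₂] ∑ β̄_{n₁}β_{n₂} 𝔲_R(n₁n̄₂; (q₁,q₂))`"), for
positive moduli: `X₁ − X₃ = mainTermsDiff`.  Proof: `1_{n₁ ≡ n₂ (g)} − φ(g)⁻¹ ∑_{χ₀ ∈ 𝒳_g(R)} χ₀(n₁n̄₂)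
= 𝔲_R(n₁ n̄₂; g)` for `(n₂, g) = 1` (`mainKernel_add_uR_eq_ite`), and `mainTermsDiff_eq`.
[cite: Drappeau2017, §5.6 (5.21)] -/
theorem mainX1_sub_mainX3_eq (R : ℝ) (a₁ a₂ : ℤ) {𝒬 : Finset ℕ} (h𝒬 : ∀ q ∈ 𝒬, 0 < q)
    (𝒩 : Finset ℕ) (γ : ℕ → ℝ) (β : ℕ → ℂ) :
    mainX1 a₁ a₂ 𝒬 𝒩 γ β - mainX3 R a₁ a₂ 𝒬 𝒩 γ β = mainTermsDiff R a₁ a₂ 𝒬 𝒩 γ β := by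
  classical
  rw [mainTermsDiff_eq R a₁ a₂ 𝒬]
  unfold mainX1 mainX3
  rw [← Finset.sum_sub_distrib]
  refine Finset.sum_congr rfl fun q₁ hq₁ => ?_
  rw [← Finset.sum_sub_distrib]
  refine Finset.sum_congr rfl fun q₂ hq₂ => ?_
  have hq₁0 : q₁ ≠ 0 := (h𝒬 q₁ (Finset.mem_filter.1 hq₁).1).ne'
  haveI : NeZero (Nat.gcd q₁ q₂) := ⟨Nat.gcd_ne_zero_left hq₁0⟩
  -- notation
  set g := Nat.gcd q₁ q₂ with hg
  set T₁ := (𝒩.filter (fun n : ℕ => IsCoprime (n : ℤ) a₂)).filter (fun n => n.Coprime q₁) with hT₁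
  set T₂ := (𝒩.filter (fun n : ℕ => IsCoprime (n : ℤ) a₂)).filter (fun n => n.Coprime q₂) with hT₂
  set 𝒳 := (univ.filter fun χ : DirichletCharacter ℂ g => (χ.conductor : ℝ) ≤ R) with h𝒳
  set w : ℂ := ((γ q₁ * γ q₂ / (Nat.lcm q₁ q₂ : ℝ) : ℝ) : ℂ) with hw
  have hu₂ : ∀ n₂ ∈ T₂, IsUnit (n₂ : ZMod g) := fun n₂ hn₂ =>
    (ZMod.isUnit_iff_coprime _ _).2
      ((Finset.mem_filter.1 hn₂).2.coprime_dvd_right (Nat.gcd_dvd_right q₁ q₂))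
  -- the kernel identity, summand by summand
  have key : ∀ n₁ ∈ T₁, ∀ n₂ ∈ T₂,
      β n₁ * starRingEnd ℂ (β n₂) * uR R g ((n₁ : ZMod g) * ((n₂ : ZMod g))⁻¹) =
        (if (n₁ : ZMod g) = (n₂ : ZMod g) then β n₁ * starRingEnd ℂ (β n₂) else 0) -
          ((Nat.totient g : ℂ))⁻¹ *
            ∑ χ₀ ∈ 𝒳, β n₁ * starRingEnd ℂ (β n₂) * χ₀ ((n₁ : ZMod g) * ((n₂ : ZMod g))⁻¹) := by
    intro n₁ _ n₂ hn₂
    obtain ⟨v, hv⟩ := hu₂ n₂ hn₂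
    have hK := mainKernel_add_uR_eq_ite R ((n₁ : ZMod g) * ((n₂ : ZMod g))⁻¹)
    have hone : ((n₁ : ZMod g) * ((n₂ : ZMod g))⁻¹ = 1) ↔ ((n₁ : ZMod g) = (n₂ : ZMod g)) := by
      rw [← hv, ZMod.inv_coe_unit, Units.mul_inv_eq_one]
    have huR : uR R g ((n₁ : ZMod g) * ((n₂ : ZMod g))⁻¹) =
        (if (n₁ : ZMod g) = (n₂ : ZMod g) then 1 else 0) -
          mainKernel R g ((n₁ : ZMod g) * ((n₂ : ZMod g))⁻¹) := by
      simp only [hone] at hK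
      linear_combination hK
    have hKer : mainKernel R g ((n₁ : ZMod g) * ((n₂ : ZMod g))⁻¹) =
        ((Nat.totient g : ℂ))⁻¹ * ∑ χ₀ ∈ 𝒳, χ₀ ((n₁ : ZMod g) * ((n₂ : ZMod g))⁻¹) := by
      unfold mainKernel
      rw [h𝒳, Finset.sum_filter]
    rw [huR, hKer, ← Finset.mul_sum]
    split_ifs <;> ring
  -- sum it
  have hsum : ∑ n₁ ∈ T₁, ∑ n₂ ∈ T₂,
      β n₁ * starRingEnd ℂ (β n₂) * uR R g ((n₁ : ZMod g) * ((n₂ : ZMod g))⁻¹) =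
      (∑ n₁ ∈ T₁, ∑ n₂ ∈ T₂,
        if (n₁ : ZMod g) = (n₂ : ZMod g) then β n₁ * starRingEnd ℂ (β n₂) else 0) -
      ((Nat.totient g : ℂ))⁻¹ * ∑ χ₀ ∈ 𝒳, ∑ n₁ ∈ T₁, ∑ n₂ ∈ T₂,
        β n₁ * starRingEnd ℂ (β n₂) * χ₀ ((n₁ : ZMod g) * ((n₂ : ZMod g))⁻¹) := by
    have h3 : ∀ F : DirichletCharacter ℂ g → ℕ → ℕ → ℂ,
        ∑ χ₀ ∈ 𝒳, ∑ n₁ ∈ T₁, ∑ n₂ ∈ T₂, F χ₀ n₁ n₂ =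
          ∑ n₁ ∈ T₁, ∑ n₂ ∈ T₂, ∑ χ₀ ∈ 𝒳, F χ₀ n₁ n₂ := by
      intro F
      rw [Finset.sum_comm (s := 𝒳) (t := T₁)]
      exact Finset.sum_congr rfl fun n₁ _ => Finset.sum_comm
    rw [Finset.sum_congr rfl fun n₁ hn₁ => Finset.sum_congr rfl fun n₂ hn₂ => key n₁ hn₁ n₂ hn₂]
    simp only [Finset.sum_sub_distrib]
    congr 1
    rw [h3, Finset.mul_sum]
    refine Finset.sum_congr rfl fun n₁ _ => ?_
    rw [Finset.mul_sum]
  rw [hsum]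
  ring

end Drappeau2017

end Literature.NumberTheory.Sieve

end
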